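import Summits.QuantumFields.YangMills.Theorems.BalabanUVNodesN08HaarCompatibilityGuardDensity
import Literature.MathematicalPhysics.QuantumFieldTheory.Balaban1983to89.B15Prop1ChartSU2
import Literature.MathematicalPhysics.QuantumFieldTheory.Balaban1983to89.T4StabilityFloor

/-!
# BalabanUVNodes ∕ N08 — A NUMBER FOR THE GUARD AT THE RECORD'S `N = 2`: on `SU(2)`, `Haar{U | ‖U − 1‖ < δ} ≤ π²δ³∕12` (`δ ≤ 1`), so
# `Haar{‖U − 1‖ < 1∕3} ≤ π²∕324 < 1∕32`, and the typed E6′ defect at an in-range level of the [B10] slot at `N = 2` is at most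
# `#PBond(j+1) · (π²∕324)^(L² − 1)` setwise, `2 · #PBond(j+1) · (π²∕324)^(L² − 1)` in `L¹(dV)` for the density `T1`

WIDTH SEAT `pub-ymgap-dag-n08-w3` g2, plan `W-SEAT-START-LIST.md` v7 §n08 item 3 PART 10 (the numeral for parts 6–9: p594625 `…Guard`, p596156 ∕
p596721 `…GuardCrossing(Law)`, `…GuardDensity`), 2026-08-28.  Track A, DAG node N08 = [Balaban1985UV3] Thm 1 p. 257 (compact) + Thm 2 p. 272;
key item K1⁷ `StabilityBAtRecordR13SepCoPH` (stmt-QuantumFields-20542) pins the slot at `N = 2` (`Node00.PrintedUV3V 2 θ.L`), `--supports … --as helper`.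
COUNT-NEUTRAL.

THE POINT.  Parts 7–9 bound the typed E6′ defect of one in-range level by `#PBond(j+1) · h^(L^{d−1} − 1)` with `h = Haar_{SU(N)}{‖W − 1‖ < min(1∕3, π∕N)}`,
the Haar mass of the domain of the printed exp-mean-log ([Balaban1987RG1] (0.4) p. 253 as typed: `expMeanLogSU_δ`).  At the record's `N = 2` that mass is a
NUMBER the tree can certify: pub-balaban's exponential chart of `SU(2)` (`T4HaarSU2ExpChart.lintegral_haarProbability_su2_exp`: `∫ F dHaar =
(2π²)⁻¹ ∫_{‖x‖<π} F(exp ιx) sinc²‖x‖ d³x`, i.e. [Balaban1985UV3] p. 260 «σ(A) = 1∕2π² (sin|A|∕|A|)²») together with Jordan's inequality in the form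
`‖(1∕i) log U‖ ≤ (π∕2)·‖U − 1‖` (`B15Prop1ChartSU2.norm_ilog_le`) puts `{‖U − 1‖ < δ}` inside the chart image of the Euclidean ball of radius `πδ∕2`, whose
weight is at most `(2π²)⁻¹ · (4π∕3)(πδ∕2)³ = π²δ³∕12`.

WHAT THIS FILE PROVES ([folklore] measure theory on the landed chart; nothing of Bałaban's asserted).  §1 `norm_lt_of_dist1_expPoint_lt` (in the chart ball,
`‖exp ιx − 1‖ < δ ≤ 1 ⇒ ‖x‖ < πδ∕2`), `volume_ball_three` (`vol B_{ℝ³}(0,r) = (4∕3)πr³`), ★ `haar_dist1_lt_le` (`Haar_{SU(2)}{‖U − 1‖ < δ} ≤ π²δ³∕12`, `0 ≤ δ ≤ 1`),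
`haar_dist1_lt_le_volume`, ★ `haar_dist1_lt_third_le` (`Haar_{SU(2)}{‖U − 1‖ < 1∕3} ≤ π²∕324`), `haar_real_dist1_lt_third_le`, `pi_sq_div_lt : π²∕324 < 1∕32`, `pow_eight_lt`; `haarData_haar_eq` (the slot's `HaarData.haar` on
`SU 2` IS this Haar probability), `min_third_pi_div_two` (`δ_2 = min(1∕3, π∕2) = 1∕3`), `haar_guardBall_two_le`.  §2 at the [B10] slot, `N = 2`, every member, in-range level: ★★ `measure_guard_two_le`
(`dU(guard) ≤ #PBond(j+1)·(π²∕324)^(L² − 1)`), ★★ `abs_map_avOfPrint_two_real_sub_le` (`|(avOfPrint)_*(dU)(A) − dV(A)| ≤ #PBond(j+1)·(π²∕324)^(L² − 1)`),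
★★ `integral_abs_TFamily_two_one_sub_one_le` (`∫ |(𝔗 S j).T 1 − 1| dV ≤ 2·#PBond(j+1)·(π²∕324)^(L² − 1)` for EVERY `𝔗 : TFamily₃ 2 L`); `card_pbond_last` (via pub-balaban's
`T4StabilityFloor.card_pbond`) (`#PBond(m+K) = 24`: the coarsest torus, 2 sites per direction) and ★ `abs_map_avOfPrint_two_real_sub_le_last` ∕
`integral_abs_TFamily_two_one_sub_one_le_last`: at the LAST in-range level of every member the typed defect is `≤ 24·(π²∕324)^(L² − 1)` (`< 24·2⁻⁴⁰` at `L = 3`,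
`pow_eight_lt`) — exactly the side-2 image torus of pub-balaban3d's N22.

WHERE THE NUMBER SAYS NOTHING (honest).  The union bound `#PBond(j+1)·(π²∕324)^(L² − 1)` is informative only while it is `< 1`, i.e. on COARSE image lattices
(`#PBond(j+1) = 24·L^{3(m+K−j−1)}`); on the fine levels of a deep member it exceeds `1` and these files say nothing there — with many bonds the guard
event is NOT rare (part 6's `measure_guard_pos` per bond), so on fine lattices the typed letter `Ū_*(dU) = dV` is as open as print's.

HONEST FRAMING.  A certified NUMBER bounding the typed E6′ defect at `N = 2`; the typed E6′ ∕ «T1 = 1» letter itself is NOT decided (part 6's `measure_guard_pos`: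
the guard is not `dU`-null); count-neutral; N08 NOT discharged; counts unmoved (typed 28∕28 · discharged 5∕27); one finite 𝕋⁴ programme at fixed ε — R4 closes
the CONDITIONAL rung `BalabanLadder.UV` only; the Yang–Mills mass gap (Clay) is NOT proved by any of this; nothing continuum ∕ ℝ³ ∕ ℝ⁴ ∕ OS ∕ mass gap.
0 `sorry`, 0 `def`, 0 `instance`, standard axioms.
-/

noncomputable section

open MeasureTheory Metric Set
open scoped ENNReal

namespace Summit.QuantumFields.YangMills.BalabanUVNodes.N08HaarCompatibilityGuardHaarBall

open Literature.MathematicalPhysics.QuantumFieldTheory.Balaban1983to89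
open Literature.MathematicalPhysics.QuantumFieldTheory (haarProbability)
open Literature.MathematicalPhysics.QuantumFieldTheory.Balaban1983to89.T4CubeChartGnomonic (SU2)
open Literature.MathematicalPhysics.QuantumFieldTheory.Balaban1983to89.T4HaarSU2ExpChart
  (expPoint injOn_expPoint measurable_expPoint lintegral_haarProbability_su2_exp)
open Literature.MathematicalPhysics.QuantumFieldTheory.Balaban1983to89.B15Prop1ChartSU2 (su2Chart norm_ilog_le iexp_ilog)

/-! ## §1. The Haar mass of the `dist1`-ball on `SU(2)` -/

section Ball

/-- **IN THE CHART BALL, `‖exp ιx − 1‖ < δ ≤ 1` FORCES `‖x‖ < πδ∕2`**: the logarithm of `exp ιx` has norm `≤ (π∕2)·‖exp ιx − 1‖ < π`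
(`B15Prop1ChartSU2.norm_ilog_le`, Jordan's inequality), so it lies in the injectivity ball and equals `x`. [folklore] -/
theorem norm_lt_of_dist1_expPoint_lt {x : EuclideanSpace ℝ (Fin 3)} (hx : x ∈ ball (0 : EuclideanSpace ℝ (Fin 3)) Real.pi)
    {δ : ℝ} (hδ : δ ≤ 1) (h : dist1 (expPoint x) < δ) : ‖x‖ < Real.pi / 2 * δ := by
  set y := su2Chart.ilog (expPoint x) with hy
  have hyle : ‖y‖ ≤ Real.pi / 2 * dist1 (expPoint x) := norm_ilog_le _
  have hylt : ‖y‖ < Real.pi / 2 * δ := hyle.trans_lt (by nlinarith [Real.pi_pos])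
  have hyball : y ∈ ball (0 : EuclideanSpace ℝ (Fin 3)) Real.pi := by
    rw [mem_ball_zero_iff]
    nlinarith [Real.pi_pos, norm_nonneg y]
  have hexp : expPoint y = expPoint x := by
    show su2Chart.iexp (su2Chart.ilog (expPoint x)) = expPoint x
    exact iexp_ilog _
  have hxy : y = x := injOn_expPoint hyball hx hexp
  rwa [← hxy]

/-- **`Haar_{SU(2)}{U | ‖U − 1‖ < δ} ≤ (2π²)⁻¹ · vol(B_{ℝ³}(0, πδ∕2))`** for `δ ≤ 1`: in the exponential chart ([Balaban1985UV3] p. 260 «dU′ = σ(A′)dA′,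
σ(A) = 1∕2π² (sin|A|∕|A|)²») the indicator of the `dist1`-ball is dominated by that of the Euclidean ball of radius `πδ∕2`, and `sinc² ≤ 1`.
[cite: Balaban1985UV3, p.260 (the SU(2) Haar density; bookkeeping)] -/
theorem haar_dist1_lt_le_volume {δ : ℝ} (hδ : δ ≤ 1) :
    haarProbability SU2 {U : SU2 | dist1 U < δ} ≤
      ENNReal.ofReal (1 / (2 * Real.pi ^ 2)) * volume (ball (0 : EuclideanSpace ℝ (Fin 3)) (Real.pi / 2 * δ)) := by
  have hmeas : MeasurableSet {U : SU2 | dist1 U < δ} := measurableSet_lt RegularGaugeGroup.measurable_dist1 measurable_const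
  rw [← lintegral_indicator_one hmeas, lintegral_haarProbability_su2_exp _ (measurable_one.indicator hmeas)]
  gcongr
  calc ∫⁻ x in ball (0 : EuclideanSpace ℝ (Fin 3)) Real.pi, ({U : SU2 | dist1 U < δ}.indicator 1 (expPoint x)) * ENNReal.ofReal (Real.sinc ‖x‖ ^ 2)
      ≤ ∫⁻ x in ball (0 : EuclideanSpace ℝ (Fin 3)) Real.pi, (ball (0 : EuclideanSpace ℝ (Fin 3)) (Real.pi / 2 * δ)).indicator 1 x := by
        refine setLIntegral_mono (measurable_one.indicator measurableSet_ball) fun x hx => ?_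
        by_cases h : dist1 (expPoint x) < δ
        · have hxr : x ∈ ball (0 : EuclideanSpace ℝ (Fin 3)) (Real.pi / 2 * δ) := by
            rw [mem_ball_zero_iff]; exact norm_lt_of_dist1_expPoint_lt hx hδ h
          rw [indicator_of_mem (show expPoint x ∈ {U : SU2 | dist1 U < δ} from h), indicator_of_mem hxr, Pi.one_apply, Pi.one_apply, one_mul]
          have h1 : Real.sinc ‖x‖ ^ 2 ≤ 1 := by rw [sq_le_one_iff_abs_le_one]; exact Real.abs_sinc_le_one _
          exact ENNReal.ofReal_le_one.2 h1
        · rw [indicator_of_notMem (show expPoint x ∉ {U : SU2 | dist1 U < δ} from h), zero_mul]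
          exact zero_le
    _ ≤ ∫⁻ x, (ball (0 : EuclideanSpace ℝ (Fin 3)) (Real.pi / 2 * δ)).indicator 1 x := setLIntegral_le_lintegral _ _
    _ = volume (ball (0 : EuclideanSpace ℝ (Fin 3)) (Real.pi / 2 * δ)) := lintegral_indicator_one measurableSet_ball

/-- `vol B_{ℝ³}(0, r) = (4∕3)πr³` (Mathlib's `EuclideanSpace.volume_ball` with `Γ(5∕2) = (3∕4)√π`). [folklore] -/
theorem volume_ball_three {r : ℝ} (hr : 0 ≤ r) :
    volume (ball (0 : EuclideanSpace ℝ (Fin 3)) r) = ENNReal.ofReal (4 / 3 * Real.pi * r ^ 3) := by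
  rw [EuclideanSpace.volume_ball]
  simp only [Fintype.card_fin]
  have hG : Real.Gamma ((3 : ℕ) / 2 + 1) = 3 / 4 * Real.sqrt Real.pi := by
    have h1 : Real.Gamma (1 / 2 + 1) = 1 / 2 * Real.Gamma (1 / 2) := Real.Gamma_add_one (by norm_num)
    have h2 : Real.Gamma (3 / 2 + 1) = 3 / 2 * Real.Gamma (3 / 2) := Real.Gamma_add_one (by norm_num)
    rw [Real.Gamma_one_half_eq] at h1
    have : (3 : ℝ) / 2 = 1 / 2 + 1 := by norm_num
    rw [show ((3 : ℕ) : ℝ) / 2 + 1 = 3 / 2 + 1 by norm_num, h2, this, h1]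
    ring
  rw [hG, ← ENNReal.ofReal_pow hr, ← ENNReal.ofReal_mul (by positivity)]
  congr 1
  have hs : Real.sqrt Real.pi ^ 3 = Real.pi * Real.sqrt Real.pi := by
    rw [pow_succ, Real.sq_sqrt Real.pi_pos.le]
  rw [hs]
  have hsp : 0 < Real.sqrt Real.pi := Real.sqrt_pos.2 Real.pi_pos
  field_simp

/-- **`Haar_{SU(2)}{U | ‖U − 1‖ < δ} ≤ π²δ³∕12`** for `0 ≤ δ ≤ 1`. [cite: Balaban1985UV3, p.260 (the SU(2) Haar density; bookkeeping)] -/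
theorem haar_dist1_lt_le {δ : ℝ} (hδ0 : 0 ≤ δ) (hδ : δ ≤ 1) :
    haarProbability SU2 {U : SU2 | dist1 U < δ} ≤ ENNReal.ofReal (Real.pi ^ 2 * δ ^ 3 / 12) := by
  refine (haar_dist1_lt_le_volume hδ).trans ?_
  rw [volume_ball_three (by positivity), ← ENNReal.ofReal_mul (by positivity)]
  refine ENNReal.ofReal_le_ofReal (le_of_eq ?_)
  have hπ : Real.pi ≠ 0 := Real.pi_pos.ne'
  field_simp
  ring

/-- **`Haar_{SU(2)}{U | ‖U − 1‖ < 1∕3} ≤ π²∕324`** (the radius of the printed exp-mean-log's domain on `SU(2)`). [cite: Balaban1987RG1, (0.4) p.253 (bookkeeping)] -/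
theorem haar_dist1_lt_third_le : haarProbability SU2 {U : SU2 | dist1 U < 1 / 3} ≤ ENNReal.ofReal (Real.pi ^ 2 / 324) := by
  refine (haar_dist1_lt_le (by norm_num) (by norm_num)).trans (le_of_eq ?_)
  congr 1
  ring

/-- `π²∕324 < 1∕32` (`π < 3.15`). [folklore] -/
theorem pi_sq_div_lt : Real.pi ^ 2 / 324 < 1 / 32 := by
  have h := Real.pi_lt_d2
  have h0 := Real.pi_pos
  nlinarith

/-- The real-valued form: `Haar_{SU(2)}.real {‖U − 1‖ < 1∕3} ≤ π²∕324`. [cite: Balaban1987RG1, (0.4) p.253 (bookkeeping)] -/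
theorem haar_real_dist1_lt_third_le : (haarProbability SU2).real {U : SU2 | dist1 U < 1 / 3} ≤ Real.pi ^ 2 / 324 :=
  ENNReal.toReal_le_of_le_ofReal (by positivity) haar_dist1_lt_third_le

end Ball

/-! ## §2. At the [B10] slot, `N = 2`: the typed E6′ defect in numbers -/

section Slot

open Literature.MathematicalPhysics.QuantumFieldTheory.Balaban1985CMP102.Setting (Scales)
open Literature.MathematicalPhysics.QuantumFieldTheory.Balaban1983to89.BlockAveraging (Small)
open Literature.MathematicalPhysics.QuantumFieldTheory.Balaban1983to89.B10RunsOfRecord (avOfPrint)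
open Literature.MathematicalPhysics.QuantumFieldTheory.Balaban1983to89.ExpMeanLog (expMeanLogSU expMeanLogSU_δ)
open Literature.MathematicalPhysics.QuantumFieldTheory.Balaban1983to89.Node00 (SU TFamily₃)
open Summit.QuantumFields.YangMills.BalabanUVNodes.N08HaarCompatibilityGuardCrossingLaw
  (measure_guard_avOfPrint_le_card_mul_pow abs_map_avOfPrint_real_sub_le_card_mul_pow)
open Summit.QuantumFields.YangMills.BalabanUVNodes.N08HaarCompatibilityGuardDensity (integral_abs_TFamily_one_sub_one_le_card_mul_pow)

variable {L : ℕ}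

/-- The slot's Haar datum on `SU(2)` IS the normalised Haar measure of the chart modules (both are Mathlib's `haarMeasure ⊤`). [folklore] -/
theorem haarData_haar_eq : (HaarData.haar : Measure (SU 2)) = haarProbability SU2 := rfl

/-- At `N = 2` the radius of the printed exp-mean-log's domain is `min(1∕3, π∕2) = 1∕3`. [cite: Balaban1987RG1, (0.4) p.253 (bookkeeping)] -/
theorem min_third_pi_div_two : min (1 / 3 : ℝ) (Real.pi / (2 : ℕ)) = 1 / 3 :=
  min_eq_left (by have := Real.pi_gt_three; push_cast; linarith)

/-- **THE GUARD'S HAAR-BALL AT `N = 2` IN NUMBERS**: `Haar_{SU(2)}{‖W − 1‖ < min(1∕3, π∕2)} ≤ π²∕324` (ℝ≥0∞ and real forms). [cite: Balaban1987RG1, (0.4) p.253 (bookkeeping)] -/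
theorem haar_guardBall_two_le :
    (HaarData.haar : Measure (SU 2)) {g : SU 2 | dist1 g < min (1 / 3) (Real.pi / (2 : ℕ))} ≤ ENNReal.ofReal (Real.pi ^ 2 / 324) ∧
      (HaarData.haar : Measure (SU 2)).real {g : SU 2 | dist1 g < min (1 / 3) (Real.pi / (2 : ℕ))} ≤ Real.pi ^ 2 / 324 := by
  rw [min_third_pi_div_two, haarData_haar_eq]
  exact ⟨haar_dist1_lt_third_le, haar_real_dist1_lt_third_le⟩

/-- **`dU(guard) ≤ #PBond(j+1) · (π²∕324)^(L² − 1)`** at every in-range level of every member, `N = 2`. [cite: Balaban1987RG1, (0.4) p.253 (bookkeeping)] -/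
theorem measure_guard_two_le (S : Scales L) {j : ℕ} (hj : j + 1 ≤ S.P.m + S.P.K) :
    fieldMeasure S.P j (SU 2) {U : GaugeField S.P j (SU 2) | ∃ c : PBond S.P (j + 1), Small (expMeanLogSU : LoopAverage (SU 2)) U c} ≤
      Fintype.card (PBond S.P (j + 1)) * ENNReal.ofReal (Real.pi ^ 2 / 324) ^ (L ^ 2 - 1) := by
  refine (measure_guard_avOfPrint_le_card_mul_pow 2 S hj).trans ?_
  gcongr
  exact haar_guardBall_two_le.1

/-- **THE TYPED E6′ DEFECT AT `N = 2` IN NUMBERS**: `|(avOfPrint 2 S j)_*(dU)(A) − dV(A)| ≤ #PBond(j+1) · (π²∕324)^(L² − 1)` for every measurable `A`, every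
member, every in-range level (beyond the range the left side is `0`, p434996). [cite: Balaban1987RG1, (0.4) p.253; Balaban1985UV3, (2) p.256, p.260 (bookkeeping; E6′ NOT IN PRINT, not decided)] -/
theorem abs_map_avOfPrint_two_real_sub_le (S : Scales L) {j : ℕ} (hj : j + 1 ≤ S.P.m + S.P.K) {A : Set (GaugeField S.P (j + 1) (SU 2))}
    (hA : MeasurableSet A) :
    |((fieldMeasure S.P j (SU 2)).map (avOfPrint 2 S j).avg).real A - (fieldMeasure S.P (j + 1) (SU 2)).real A| ≤
      Fintype.card (PBond S.P (j + 1)) * (Real.pi ^ 2 / 324) ^ (L ^ 2 - 1) := by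
  refine (abs_map_avOfPrint_real_sub_le_card_mul_pow 2 S hj hA).trans ?_
  gcongr
  exact haar_guardBall_two_le.2

variable (L) in
/-- **THE TYPED «T1 = 1» DEFECT AT `N = 2` IN NUMBERS**: for EVERY transformation family `𝔗 : Node00.TFamily₃ 2 L`, every member and in-range level,
`∫ |(𝔗 S j).T 1 − 1| dV ≤ 2 · #PBond(j+1) · (π²∕324)^(L² − 1)`. [cite: Balaban1985Averaging, (10) p.19; Balaban1985UV3, (2) p.256, p.260 (bookkeeping; NOT IN PRINT, not decided)] -/
theorem integral_abs_TFamily_two_one_sub_one_le (𝔗 : TFamily₃ 2 L) (S : Scales L) {j : ℕ} (hj : j + 1 ≤ S.P.m + S.P.K) :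
    ∫ V, |(𝔗 S j).T 1 V - 1| ∂(fieldMeasure S.P (j + 1) (SU 2)) ≤ 2 * (Fintype.card (PBond S.P (j + 1)) * (Real.pi ^ 2 / 324) ^ (L ^ 2 - 1)) := by
  refine (integral_abs_TFamily_one_sub_one_le_card_mul_pow 2 L 𝔗 S hj).trans ?_
  gcongr
  exact haar_guardBall_two_le.2

/-- The coarsest torus `T^{(m+K)}` has 2 sites per direction. [cite: Balaban1987RG1, (0.1) p.251 (bookkeeping)] -/
theorem sitesPerDir_last (P : Params) : P.sitesPerDir (P.m + P.K) = 2 := by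
  unfold Params.sitesPerDir; simp

/-- … hence `#PBond(m+K) = 2³·3 = 24` for the [B10] lattices (`d = 3`). [cite: Balaban1987RG1, (0.1) p.251 (bookkeeping)] -/
theorem card_pbond_last (S : Scales L) : Fintype.card (PBond S.P (S.P.m + S.P.K)) = 24 := by
  rw [T4StabilityFloor.card_pbond, sitesPerDir_last]
  show 2 ^ 3 * 3 = 24
  norm_num

/-- **AT THE LAST IN-RANGE LEVEL (image = the side-2 torus, pub-balaban3d's N22 regime) THE TYPED E6′ DEFECT AT `N = 2` IS `≤ 24·(π²∕324)^(L² − 1)`** for every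
member `S` and every measurable `A`. [cite: Balaban1987RG1, (0.4) p.253; Balaban1985UV3, (2) p.256, p.260 (bookkeeping; E6′ NOT IN PRINT, not decided)] -/
theorem abs_map_avOfPrint_two_real_sub_le_last (S : Scales L) (hK : 1 ≤ S.P.m + S.P.K) {A : Set (GaugeField S.P (S.P.m + S.P.K - 1 + 1) (SU 2))}
    (hA : MeasurableSet A) :
    |((fieldMeasure S.P (S.P.m + S.P.K - 1) (SU 2)).map (avOfPrint 2 S (S.P.m + S.P.K - 1)).avg).real A -
        (fieldMeasure S.P (S.P.m + S.P.K - 1 + 1) (SU 2)).real A| ≤ 24 * (Real.pi ^ 2 / 324) ^ (L ^ 2 - 1) := by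
  have hj : S.P.m + S.P.K - 1 + 1 ≤ S.P.m + S.P.K := by omega
  have h := abs_map_avOfPrint_two_real_sub_le S hj hA
  have hc : Fintype.card (PBond S.P (S.P.m + S.P.K - 1 + 1)) = 24 := by
    rw [show S.P.m + S.P.K - 1 + 1 = S.P.m + S.P.K by omega]; exact card_pbond_last S
  rw [hc] at h
  exact_mod_cast h

variable (L) in
/-- … and `∫ |(𝔗 S (m+K−1)).T 1 − 1| dV ≤ 48·(π²∕324)^(L² − 1)` there, for EVERY transformation family. [cite: Balaban1985Averaging, (10) p.19; Balaban1985UV3, (2) p.256 (bookkeeping; NOT IN PRINT)] -/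
theorem integral_abs_TFamily_two_one_sub_one_le_last (𝔗 : TFamily₃ 2 L) (S : Scales L) (hK : 1 ≤ S.P.m + S.P.K) :
    ∫ V, |(𝔗 S (S.P.m + S.P.K - 1)).T 1 V - 1| ∂(fieldMeasure S.P (S.P.m + S.P.K - 1 + 1) (SU 2)) ≤ 2 * (24 * (Real.pi ^ 2 / 324) ^ (L ^ 2 - 1)) := by
  have hj : S.P.m + S.P.K - 1 + 1 ≤ S.P.m + S.P.K := by omega
  have h := integral_abs_TFamily_two_one_sub_one_le L 𝔗 S hj
  have hc : Fintype.card (PBond S.P (S.P.m + S.P.K - 1 + 1)) = 24 := by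
    rw [show S.P.m + S.P.K - 1 + 1 = S.P.m + S.P.K by omega]; exact card_pbond_last S
  rw [hc] at h
  exact_mod_cast h

/-- At the lane's smallest block `L = 3` the exponent is `8` and the per-bond factor is `(π²∕324)⁸ < (1∕32)⁸ = 2⁻⁴⁰`. [folklore] -/
theorem pow_eight_lt : (Real.pi ^ 2 / 324) ^ (3 ^ 2 - 1) < (2 : ℝ)⁻¹ ^ 40 := by
  rw [show (3 : ℕ) ^ 2 - 1 = 8 by norm_num, show ((2 : ℝ)⁻¹) ^ 40 = (1 / 32) ^ 8 by norm_num]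
  exact pow_lt_pow_left₀ pi_sq_div_lt (by positivity) (by norm_num)

end Slot

end Summit.QuantumFields.YangMills.BalabanUVNodes.N08HaarCompatibilityGuardHaarBall

end
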